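import Summits.Ventures.PercRepro.S1CapTenSix

/-!
# PercRepro — THE CELL `(10, 7)` ON THE PER-`t` CAPS `46 / 39 / 32` (p2, gen 25; SUBCLAIM-S1 §6.9 (xii) T1)

The conull consumer of `S1ChainCellTenSevenCond` re-run with the cap table `S(t) = 47` (`t ≤ 8`), `46` (`t = 9`),
`39` (`t = 10`), `32` (`t ≥ 11`) — the largest values that close every `(A)`/`(B)`-line of the coloop-free case
(exact twin mining/p2/g25/caps107.py: `47 / 40 / 33` fail by `413 / 329 / 245`). The three caps are then discharged
on the union `S₀` of the triangles (S1TriangleUnionSix / S1CellTenSevenSmall): `t ≥ 11` is vacuous (`s₃ ≤ 10`),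
`t = 10` holds with `30` (S1CapTenSix), and at `t = 9` the core has at most one four-circuit outside `S₀`, so any
cap `B₉ ≤ 45` on the restriction suffices:

* `capTenSevenT` — the cap table; `rrTenSevenT` — the chain lengths (as in S1ChainCellTenSevenCond);
* `fourCircuits_core_le` — the reduction of the core's `s₄` to the restriction's, with parameters;
* **`c025_core_ten_seven_of_caps`** — the cell from `(P10)` at `B₁₀ ≤ 39` and `(P9)` at `B₉ ≤ 45`;
* **`c025_core_ten_seven_of_cap_nine'`** — the cell from `(P9)` at `45` alone (`(P10)` is in the tree).
Axioms: standard.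
-/

open scoped Matroid

namespace PercRepro

namespace S1

open Set

variable {α : Type}

/-- The four-circuit cap of the coloop-free lines at triangle count `t`: `47, 46, 39, 32` for
`t ≤ 8, = 9, = 10, ≥ 11`. -/
def capTenSevenT (t : ℕ) : ℕ := if t ≤ 8 then 47 else if t = 9 then 46 else if t = 10 then 39 else 32

/-- The chain length `r` at each `t = s₃` (coloop-free case; as `rrTenSeven0`). -/
def rrTenSevenT (t : ℕ) : ℕ := [0, 1, 1, 1, 1, 4, 5, 5, 6, 6, 6, 6].getD t 0

/-- **The reduction of the core's four-circuits to the restriction's**, with the caps as parameters: on a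
coloop-free `e`-free core of nullity `7` with `17` points and `s₃ ≥ 9`, `s₄ ≤ B₁₀` when `s₃ = 10` and
`s₄ ≤ B₉ + 1` when `s₃ = 9`, provided (P10) holds with `B₁₀` and (P9) with `B₉`. -/
theorem fourCircuits_core_le (N : Matroid α) [N.Finite]
    (hNfree : ∀ e ∈ N.E, ∃ A ⊆ N.E \ {e}, e ∉ N.closure A ∧ e ∉ N.closure ((N.E \ {e}) \ A))
    (hNd : N.E.encard = N.eRank + ((7 : ℕ) : ℕ∞)) (hNn : N.E.ncard = 17) (hNcol : N.coloops = ∅)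
    (h9 : 9 ≤ {C : Set α | N.IsCircuit C ∧ C.ncard = 3}.ncard) {B₉ B₁₀ : ℕ}
    (hP10 : ∀ (N' : Matroid α) [N'.Finite],
      (∀ e ∈ N'.E, ∃ A ⊆ N'.E \ {e}, e ∉ N'.closure A ∧ e ∉ N'.closure ((N'.E \ {e}) \ A)) →
      N'.E.encard = N'.eRank + ((6 : ℕ) : ℕ∞) → N'.E.ncard ≤ 10 →
      {C : Set α | N'.IsCircuit C ∧ C.ncard = 3}.ncard = 10 →
      (∀ x ∈ N'.E, 3 ≤ {C : Set α | N'.IsCircuit C ∧ C.ncard = 3 ∧ x ∈ C}.ncard) →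
      {C : Set α | N'.IsCircuit C ∧ C.ncard = 4}.ncard ≤ B₁₀)
    (hP9 : ∀ (N' : Matroid α) [N'.Finite],
      (∀ e ∈ N'.E, ∃ A ⊆ N'.E \ {e}, e ∉ N'.closure A ∧ e ∉ N'.closure ((N'.E \ {e}) \ A)) →
      N'.E.encard = N'.eRank + ((6 : ℕ) : ℕ∞) → N'.E.ncard ≤ 13 →
      {C : Set α | N'.IsCircuit C ∧ C.ncard = 3}.ncard = 9 →
      (∀ x ∈ N'.E, 2 ≤ {C : Set α | N'.IsCircuit C ∧ C.ncard = 3 ∧ x ∈ C}.ncard) →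
      {C : Set α | N'.IsCircuit C ∧ C.ncard = 4}.ncard ≤ B₉) :
    ({C : Set α | N.IsCircuit C ∧ C.ncard = 3}.ncard = 10 → {C : Set α | N.IsCircuit C ∧ C.ncard = 4}.ncard ≤ B₁₀) ∧
    ({C : Set α | N.IsCircuit C ∧ C.ncard = 3}.ncard = 9 → {C : Set α | N.IsCircuit C ∧ C.ncard = 4}.ncard ≤ B₉ + 1) := by
  obtain ⟨S, hSE, -, hcov, hsub, hν, hfour⟩ := exists_triangle_union N hNfree hNd hNn hNcol h9
  obtain ⟨h10, hs10, hs9, hdeg⟩ := triangle_union_bounds N hNfree hNn hSE hcov hsub hν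
  have hEfin : N.E.Finite := N.ground_finite
  have hSfin : S.Finite := hEfin.subset hSE
  haveI : (N ↾ S).Finite := N.restrict_finite hSfin
  have hfree' := hfree_restrict N hNfree hSE
  have hd' : (N ↾ S).E.encard = (N ↾ S).eRank + ((6 : ℕ) : ℕ∞) := by
    rw [Matroid.restrict_ground_eq, Matroid.eRank_restrict]; exact hν
  have hn' : (N ↾ S).E.ncard = S.ncard := by rw [Matroid.restrict_ground_eq]
  have htri' : {C : Set α | (N ↾ S).IsCircuit C ∧ C.ncard = 3} = {C : Set α | N.IsCircuit C ∧ C.ncard = 3} := by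
    ext C
    simp only [Set.mem_setOf_eq, Matroid.restrict_isCircuit_iff hSE]
    constructor
    · rintro ⟨⟨hC, -⟩, h3⟩; exact ⟨hC, h3⟩
    · rintro ⟨hC, h3⟩; exact ⟨⟨hC, hsub C hC h3⟩, h3⟩
  have hdeg' : ∀ x, {C : Set α | (N ↾ S).IsCircuit C ∧ C.ncard = 3 ∧ x ∈ C} =
      {C : Set α | N.IsCircuit C ∧ C.ncard = 3 ∧ x ∈ C} := by
    intro x
    ext C
    simp only [Set.mem_setOf_eq, Matroid.restrict_isCircuit_iff hSE]
    constructor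
    · rintro ⟨⟨hC, -⟩, h3, hx⟩; exact ⟨hC, h3, hx⟩
    · rintro ⟨hC, h3, hx⟩; exact ⟨⟨hC, hsub C hC h3⟩, h3, hx⟩
  have hfour' : {C : Set α | (N ↾ S).IsCircuit C ∧ C.ncard = 4} =
      {C : Set α | N.IsCircuit C ∧ C.ncard = 4 ∧ C ⊆ S} := by
    ext C
    simp only [Set.mem_setOf_eq, Matroid.restrict_isCircuit_iff hSE]
    tauto
  have hdegS : ∀ x ∈ (N ↾ S).E, {C : Set α | N.IsCircuit C ∧ C.ncard = 3}.ncard ≤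
      {C : Set α | (N ↾ S).IsCircuit C ∧ C.ncard = 3 ∧ x ∈ C}.ncard + 7 := by
    intro x hx
    rw [Matroid.restrict_ground_eq] at hx
    rw [hdeg']
    exact hdeg x hx
  have hAfin : {C : Set α | N.IsCircuit C ∧ C.ncard = 4 ∧ C ⊆ S}.Finite :=
    (finite_fourCircuits N).subset (fun C hC => ⟨hC.1, hC.2.1⟩)
  have hBfin : {C : Set α | N.IsCircuit C ∧ C.ncard = 4 ∧ ¬ C ⊆ S}.Finite :=
    (finite_fourCircuits N).subset (fun C hC => ⟨hC.1, hC.2.1⟩)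
  have hsplit : {C : Set α | N.IsCircuit C ∧ C.ncard = 4} =
      {C : Set α | N.IsCircuit C ∧ C.ncard = 4 ∧ C ⊆ S} ∪ {C : Set α | N.IsCircuit C ∧ C.ncard = 4 ∧ ¬ C ⊆ S} := by
    ext C
    simp only [Set.mem_setOf_eq, Set.mem_union]
    tauto
  have hdisj : Disjoint {C : Set α | N.IsCircuit C ∧ C.ncard = 4 ∧ C ⊆ S}
      {C : Set α | N.IsCircuit C ∧ C.ncard = 4 ∧ ¬ C ⊆ S} := by
    rw [Set.disjoint_left]
    rintro C ⟨-, -, h⟩ ⟨-, -, h'⟩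
    exact h' h
  have hout : ∀ C, N.IsCircuit C → C.ncard = 4 → ¬ C ⊆ S → N.E \ S ⊆ C :=
    fun C hC h4 hCS => (hfour C hC h4).resolve_left hCS
  have hXcard : (N.E \ S).ncard = 17 - S.ncard := by
    rw [Set.ncard_sdiff hSE hSfin, hNn]
  rw [hsplit, Set.ncard_union_eq hdisj hAfin hBfin]
  constructor
  · intro hs
    have hS10 := hs10 hs
    have houteq : {C : Set α | N.IsCircuit C ∧ C.ncard = 4 ∧ ¬ C ⊆ S}.ncard = 0 := by
      rw [Set.ncard_eq_zero hBfin, Set.eq_empty_iff_forall_notMem]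
      rintro C ⟨hC, h4, hCS⟩
      have hXC := hout C hC h4 hCS
      have hCfin : C.Finite := hEfin.subset hC.subset_ground
      have := Set.ncard_le_ncard hXC hCfin
      omega
    have hin := hP10 (N ↾ S) hfree' hd' (by rw [hn']; exact hS10) (by rw [htri']; exact hs)
      (fun x hx => by have := hdegS x hx; omega)
    rw [hfour'] at hin
    omega
  · intro hs
    have hS13 := hs9 hs
    have houtle : {C : Set α | N.IsCircuit C ∧ C.ncard = 4 ∧ ¬ C ⊆ S}.ncard ≤ 1 := by
      refine (Set.ncard_le_ncard (t := {N.E \ S}) ?_ (Set.finite_singleton _)).trans (by simp)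
      rintro C ⟨hC, h4, hCS⟩
      have hXC := hout C hC h4 hCS
      have hCfin : C.Finite := hEfin.subset hC.subset_ground
      have hXge : 4 ≤ (N.E \ S).ncard := by omega
      have heq : N.E \ S = C := Set.eq_of_subset_of_ncard_le hXC (by omega) hCfin
      rw [Set.mem_singleton_iff, heq]
    have hin := hP9 (N ↾ S) hfree' hd' (by rw [hn']; exact hS13) (by rw [htri']; exact hs)
      (fun x hx => by have := hdegS x hx; omega)
    rw [hfour'] at hin
    omega

/-- **THE CELL `(10, 7)` ON THE CAP TABLE**: `RLS` at `(10, 4)` on every `e`-free core of rank `10` with `17` points,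
provided (P10) holds with some `B₁₀ ≤ 39` and (P9) with some `B₉ ≤ 45`. -/
theorem c025_core_ten_seven_of_caps (M : Matroid α) [M.Finite] (hR : M.eRank = (10 : ℕ)) (hn : M.E.ncard = 17)
    (hfree : ∀ e ∈ M.E, ∃ A ⊆ M.E \ {e}, e ∉ M.closure A ∧ e ∉ M.closure ((M.E \ {e}) \ A))
    {B₉ B₁₀ : ℕ} (hB₉ : B₉ + 1 ≤ 46) (hB₁₀ : B₁₀ ≤ 39)
    (hP10 : ∀ (N : Matroid α) [N.Finite],
      (∀ e ∈ N.E, ∃ A ⊆ N.E \ {e}, e ∉ N.closure A ∧ e ∉ N.closure ((N.E \ {e}) \ A)) →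
      N.E.encard = N.eRank + ((6 : ℕ) : ℕ∞) → N.E.ncard ≤ 10 →
      {C : Set α | N.IsCircuit C ∧ C.ncard = 3}.ncard = 10 →
      (∀ x ∈ N.E, 3 ≤ {C : Set α | N.IsCircuit C ∧ C.ncard = 3 ∧ x ∈ C}.ncard) →
      {C : Set α | N.IsCircuit C ∧ C.ncard = 4}.ncard ≤ B₁₀)
    (hP9 : ∀ (N : Matroid α) [N.Finite],
      (∀ e ∈ N.E, ∃ A ⊆ N.E \ {e}, e ∉ N.closure A ∧ e ∉ N.closure ((N.E \ {e}) \ A)) →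
      N.E.encard = N.eRank + ((6 : ℕ) : ℕ∞) → N.E.ncard ≤ 13 →
      {C : Set α | N.IsCircuit C ∧ C.ncard = 3}.ncard = 9 →
      (∀ x ∈ N.E, 2 ≤ {C : Set α | N.IsCircuit C ∧ C.ncard = 3 ∧ x ∈ C}.ncard) →
      {C : Set α | N.IsCircuit C ∧ C.ncard = 4}.ncard ≤ B₉) :
    ThmN.RLS M 10 4 := by
  rcases (show M.coloops.ncard = 0 ∨ M.coloops.ncard = 1 ∨ M.coloops.ncard = 2 ∨ 3 ≤ M.coloops.ncard by omega)
    with h | h | h | h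
  · refine rls_of_ladder_case_chain_conull_capT M (p := 10) (c := 0) (d := 7) (by norm_num) (by norm_num) hR hn hfree h
      (by norm_num) (by norm_num) (P := 11) (S5 := 331) capTenSevenT (by decide) ?_
      (by decide) rrTenSevenT (by decide) (by decide +kernel) (by decide +kernel) (by decide +kernel)
    intro N _ hNfree hNd hNn hNcol t ht
    unfold capTenSevenT
    split_ifs with h8 h9 h10
    · exact gb_cap_seven 10 17 47 rfl (by decide) N hNfree hNd hNn hNcol
    · have hred := fourCircuits_core_le N hNfree hNd hNn hNcol (by omega) hP10 hP9
      have := hred.2 (by omega)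
      omega
    · have hred := fourCircuits_core_le N hNfree hNd hNn hNcol (by omega) hP10 hP9
      have := hred.1 (by omega)
      omega
    · exfalso
      obtain ⟨S, hSE, -, hcov, hsub, hν, -⟩ := exists_triangle_union N hNfree hNd hNn hNcol (by omega)
      obtain ⟨h10', -, -, -⟩ := triangle_union_bounds N hNfree hNn hSE hcov hsub hν
      omega
  · exact rls_of_ladder_case_chain_conull M (p := 9) (c := 1) (d := 7) (by norm_num) (by norm_num) hR hn hfree h
      (by norm_num) (by norm_num) (P := 11) (S := 49) (S5 := 340) (by decide) (gb_cap_seven 9 16 49 rfl (by decide))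
      (by decide) rrTenSeven1 (by decide) (by decide +kernel) (by decide +kernel) (by decide +kernel)
  · exact rls_of_ladder_case_chain_conull M (p := 8) (c := 2) (d := 7) (by norm_num) (by norm_num) hR hn hfree h
      (by norm_num) (by norm_num) (P := 11) (S := 57) (S5 := 351) (by decide) (gb_cap_seven 8 15 57 rfl (by decide))
      (by decide) rrTenSeven2 (by decide) (by decide +kernel) (by decide +kernel) (by decide +kernel)
  · exact rls_of_coloops_lossy M (p := 7) (c := 3) (hR.trans (by norm_num)) (by norm_num) h phiK_ten_four_le

/-- **THE CELL `(10, 7)` MODULO (P9) AT `45`**: with (P10) in the tree (`cap_ten_of_nullity_six`, `30 ≤ 39`), the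
cell follows from «every `e`-free matroid of nullity `6` with `≤ 13` points, `9` triangles and every point on
`≥ 2` triangles has `≤ 45` four-circuits». -/
theorem c025_core_ten_seven_of_cap_nine' (M : Matroid α) [M.Finite] (hR : M.eRank = (10 : ℕ)) (hn : M.E.ncard = 17)
    (hfree : ∀ e ∈ M.E, ∃ A ⊆ M.E \ {e}, e ∉ M.closure A ∧ e ∉ M.closure ((M.E \ {e}) \ A))
    (hP9 : ∀ (N : Matroid α) [N.Finite],
      (∀ e ∈ N.E, ∃ A ⊆ N.E \ {e}, e ∉ N.closure A ∧ e ∉ N.closure ((N.E \ {e}) \ A)) →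
      N.E.encard = N.eRank + ((6 : ℕ) : ℕ∞) → N.E.ncard ≤ 13 →
      {C : Set α | N.IsCircuit C ∧ C.ncard = 3}.ncard = 9 →
      (∀ x ∈ N.E, 2 ≤ {C : Set α | N.IsCircuit C ∧ C.ncard = 3 ∧ x ∈ C}.ncard) →
      {C : Set α | N.IsCircuit C ∧ C.ncard = 4}.ncard ≤ 45) :
    ThmN.RLS M 10 4 :=
  c025_core_ten_seven_of_caps M hR hn hfree (B₉ := 45) (B₁₀ := 32) (by norm_num) (by norm_num)
    (fun N _ hfree' hd hn' h10 hdeg => cap_ten_of_nullity_six N hfree' hd hn' h10 hdeg) hP9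

end S1

end PercRepro
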